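import Mathlib
import Summits.ResolutionOfSingularities.ResolutionOfSingularities.Theorems.FrobeniusLadderFRationalResolutionCompletedBaseChangeFibreFlat
import Summits.ResolutionOfSingularities.ResolutionOfSingularities.Theorems.FrobeniusLadderFRationalResolutionBlowupRegularFlatChart

/-!
# Crux `FrobeniusLadder.FRationalResolution` (stmt-ResolutionOfSingularities-15317), line `redirect`,
# stub `stub_diagonalizableQuotientResolution` — the fibre engine of `…CompletedBaseChangeFibre(Flat)`, DESCENT OF `Bl_𝔪`-REGULARITY
# WITHOUT G-RINGS: `Bl_𝔪(Spec (C ⊗_A B)_𝔑)` regular ⇒ `Bl_𝔪(Spec C_𝔫)` regular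

In the fibre engine (`B` a flat `A`-algebra with `B = A + 𝔪B`, `C` any `A`-algebra, `𝔫 ⊇ 𝔪C` prime, `𝔑 = 𝔫(C ⊗_A B)` THE prime over
`𝔫`) the local homomorphism `C_𝔫 → (C ⊗_A B)_𝔑` is flat, hence faithfully flat, and UNRAMIFIED in the strong sense
`𝔪_{C_𝔫} (C ⊗_A B)_𝔑 = 𝔪_{(C ⊗_A B)_𝔑}`. So `Bl_𝔪(Spec (C ⊗_A B)_𝔑) = Bl_𝔪(Spec C_𝔫) ×_{C_𝔫} (C ⊗_A B)_𝔑` and regularity of the point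
blow-up DESCENDS (`…BlowupRegularFlatChart.isRegular_affineBlowup_of_faithfullyFlat`) — with no G-ring / excellence hypothesis on
either side (the tree's `…CompletedBaseChangeFibreDown` went through the completions and needed `C ⊗_A B` to be a G-ring, which is
available for `B = A_𝔮` but NOT for `B = Â` over a complete local base). This is the brick that lets the two-step datum of the
étale descent (ε) (`…EtaleChartTwoStep`, p842696) come DOWN from the completion `(C_𝔔)^` of the étale chart's local ring.

* `map_maximalIdeal_eq` — `𝔪_{C_𝔫} (C ⊗_A B)_𝔑 = 𝔪_{(C ⊗_A B)_𝔑}`;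
* ★★ `isRegular_affineBlowup_maximalIdeal_descent` — the descent statement;
* ★★ `isRegular_affineBlowup_maximalIdeal_descent_model` — MODEL FORM `B = (T_𝔳)^`, `𝔳` maximal (all hypotheses discharged).

Honest label: ring/scheme plumbing toward ONE leaf stub (no stub, crux or summit closed). No definitions, no named facts, no sorry.
[cite: Matsumura1987, Thm. 8.8; Thm. 23.7 (i)] [cite: GortzWedhorn2020, Prop. 13.91 (2)] [cite: StacksProject, Tag 0C4G]
-/

noncomputable section

-- single-problem summit: the doubled namespace component is forced
set_option linter.dupNamespace false

open IsLocalRing AlgebraicGeometry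
open scoped TensorProduct
open Literature.AlgebraicGeometry.Resolution

namespace Summit.ResolutionOfSingularities.ResolutionOfSingularities.Theorems.FRationalResolution.CompletedBaseChangeFibreDescent

variable {A B C : Type} [CommRing A] [CommRing B] [CommRing C] [Algebra A B] [Algebra A C]

/-- **`𝔪_{C_𝔫} (C ⊗_A B)_𝔑 = 𝔪_{(C ⊗_A B)_𝔑}`** in the fibre engine (`B = A + 𝔪B`, `𝔫 ⊇ 𝔪C`, `𝔑` over `𝔫`, so that
`𝔑 = 𝔫 (C ⊗_A B)`), for the canonical algebra structure `C_𝔫 → (C ⊗_A B)_𝔑`. [cite: StacksProject, Tag 0C4G] [folklore] -/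
theorem map_maximalIdeal_eq (𝔪 : Ideal A)
    (hres : ∀ b : B, ∃ a : A, b - algebraMap A B a ∈ 𝔪.map (algebraMap A B))
    (𝔫 : Ideal C) [𝔫.IsPrime] (h𝔫 : 𝔪.map (algebraMap A C) ≤ 𝔫)
    (𝔑 : Ideal (C ⊗[A] B)) [𝔑.IsPrime] (h𝔑 : 𝔑.comap (algebraMap C (C ⊗[A] B)) = 𝔫)
    [Algebra (Localization.AtPrime 𝔫) (Localization.AtPrime 𝔑)]
    [IsScalarTower C (Localization.AtPrime 𝔫) (Localization.AtPrime 𝔑)] :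
    (maximalIdeal (Localization.AtPrime 𝔫)).map (algebraMap (Localization.AtPrime 𝔫) (Localization.AtPrime 𝔑)) =
      maximalIdeal (Localization.AtPrime 𝔑) := by
  have h𝔑eq := CompletedBaseChangeFibre.eq_map_of_comap_eq (B := B) 𝔪 hres 𝔫 h𝔫 h𝔑
  rw [← Localization.AtPrime.map_eq_maximalIdeal, Ideal.map_map,
    ← IsScalarTower.algebraMap_eq C (Localization.AtPrime 𝔫) (Localization.AtPrime 𝔑),
    IsScalarTower.algebraMap_eq C (C ⊗[A] B) (Localization.AtPrime 𝔑), ← Ideal.map_map, ← h𝔑eq,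
    Localization.AtPrime.map_eq_maximalIdeal]

/-- ★★ **DESCENT OF `Bl_𝔪`-REGULARITY in the fibre engine, no G-rings.** `B` a FLAT `A`-algebra with `B = A + 𝔪B`, `C` any
`A`-algebra with `C` Noetherian, `𝔫 ⊇ 𝔪C` prime, `𝔑` a prime of `C ⊗_A B` over `𝔫`: if `Bl_𝔪(Spec (C ⊗_A B)_𝔑)` is regular then
`Bl_𝔪(Spec C_𝔫)` is regular. [cite: Matsumura1987, Thm. 23.7 (i)] [cite: GortzWedhorn2020, Prop. 13.91 (2)] -/
theorem isRegular_affineBlowup_maximalIdeal_descent [Module.Flat A B] [IsNoetherianRing C] (𝔪 : Ideal A)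
    (hres : ∀ b : B, ∃ a : A, b - algebraMap A B a ∈ 𝔪.map (algebraMap A B))
    (𝔫 : Ideal C) [𝔫.IsPrime] (h𝔫 : 𝔪.map (algebraMap A C) ≤ 𝔫)
    (𝔑 : Ideal (C ⊗[A] B)) [𝔑.IsPrime] (h𝔑 : 𝔑.comap (algebraMap C (C ⊗[A] B)) = 𝔫)
    (h : Scheme.IsRegular (affineBlowup (R := Localization.AtPrime 𝔑) (maximalIdeal _))) :
    Scheme.IsRegular (affineBlowup (R := Localization.AtPrime 𝔫) (maximalIdeal _)) := by
  haveI : 𝔑.LiesOver 𝔫 := ⟨h𝔑.symm⟩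
  letI := Localization.AtPrime.algebraOfLiesOver 𝔫 𝔑
  haveI : IsNoetherianRing (Localization.AtPrime 𝔫) :=
    IsLocalization.isNoetherianRing 𝔫.primeCompl (Localization.AtPrime 𝔫) inferInstance
  -- `C → C ⊗_A B` is flat, hence so is `C_𝔫 → (C ⊗_A B)_𝔑`; local, hence faithfully flat
  haveI : Module.Flat C (C ⊗[A] B) := inferInstance
  haveI : Module.Flat (Localization.AtPrime 𝔫) (Localization.AtPrime 𝔑) := inferInstance
  haveI : IsLocalHom (algebraMap (Localization.AtPrime 𝔫) (Localization.AtPrime 𝔑)) := by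
    change IsLocalHom (Localization.localRingHom 𝔫 𝔑 (algebraMap C (C ⊗[A] B)) Ideal.LiesOver.over)
    infer_instance
  haveI : Module.FaithfullyFlat (Localization.AtPrime 𝔫) (Localization.AtPrime 𝔑) :=
    Module.FaithfullyFlat.of_flat_of_isLocalHom
  refine BlowupRegularFlatChart.isRegular_affineBlowup_of_faithfullyFlat (C := Localization.AtPrime 𝔑) _ ?_
  rw [map_maximalIdeal_eq 𝔪 hres 𝔫 h𝔫 𝔑 h𝔑]
  exact h

/-- ★★ **MODEL FORM** (`T` Noetherian, `𝔳` maximal, `B = (T_𝔳)^`): for a Noetherian `T`-algebra `C`, a prime `𝔫 ⊇ 𝔳C` and a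
prime `𝔑` of `C ⊗_T (T_𝔳)^` over `𝔫`, regularity of `Bl_𝔪(Spec (C ⊗_T (T_𝔳)^)_𝔑)` implies regularity of `Bl_𝔪(Spec C_𝔫)`.
[cite: Matsumura1987, Thm. 8.8; Thm. 8.11; Thm. 23.7 (i)] -/
theorem isRegular_affineBlowup_maximalIdeal_descent_model (T : Type) [CommRing T] [IsNoetherianRing T] (𝔳 : Ideal T)
    [𝔳.IsMaximal] {C : Type} [CommRing C] [Algebra T C] [IsNoetherianRing C]
    (𝔫 : Ideal C) [𝔫.IsPrime] (h𝔫 : 𝔳.map (algebraMap T C) ≤ 𝔫)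
    (𝔑 : Ideal (C ⊗[T] AdicCompletion (maximalIdeal (Localization.AtPrime 𝔳)) (Localization.AtPrime 𝔳))) [𝔑.IsPrime]
    (h𝔑 : 𝔑.comap (algebraMap C _) = 𝔫)
    (h : Scheme.IsRegular (affineBlowup (R := Localization.AtPrime 𝔑) (maximalIdeal _))) :
    Scheme.IsRegular (affineBlowup (R := Localization.AtPrime 𝔫) (maximalIdeal _)) := by
  haveI := CompletedBaseChangeFibreFlat.flat_adicCompletion_atPrime T 𝔳
  exact isRegular_affineBlowup_maximalIdeal_descent 𝔳
    (CompletedBaseChangeFibreFlat.forall_exists_sub_mem_adicCompletion_atPrime T 𝔳) 𝔫 h𝔫 𝔑 h𝔑 h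

end Summit.ResolutionOfSingularities.ResolutionOfSingularities.Theorems.FRationalResolution.CompletedBaseChangeFibreDescent

end
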